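import Literature.AlgebraicGeometry.Morphisms.Devissage
import Literature.AlgebraicGeometry.Morphisms.CechModule
import Literature.AlgebraicGeometry.Modules.TorsionStable
import Literature.AlgebraicGeometry.Modules.TorsionLocalizing
import Literature.AlgebraicGeometry.Modules.IdealMul
import Literature.AlgebraicGeometry.Modules.PullbackCoh
import Mathlib.AlgebraicGeometry.IdealSheaf.Functorial
import HarnessLib

/-!
# The torsion-free twist package `r^*M → r^*M/(𝓙-torsion) ← 𝓙ⁿ · (r^*M/(𝓙-torsion))` along a
# morphism, reduced to the local vanishing of `H¹` of `𝓙ⁿ·G` for torsion-free coherent `G`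

Setting: a morphism of schemes `r : S′ → X` with `X`, `S′` locally Noetherian and `S′` quasi-compact,
an ideal sheaf `J` on `X` with inverse image `𝓙 = J·𝒪_{S′}` (Mathlib `IdealSheafData.comap`), and
a COHERENT `𝒪_X`-module `M` (`Morphisms.Coh`).  Out of tree constructions only — the inverse image
`r^*M` (Mathlib; coherent by `Modules/PullbackCoh.coh_pullback`), the stable torsion subsheaf
`(r^*M)[𝓙ᵏ]` (`Modules/Torsion`, `Modules/TorsionStable.exists_torsion_pow_stable`), its cokernel
`P = r^*M / (r^*M)[𝓙ᵏ]` (which has NO `𝓙`-torsion, `torsionFree_cokernel_torsionι`; Hartshorne II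
Ex. 5.6 (d)) and the product submodules `𝓙ⁿP ⊆ P` (`Modules/IdealMul`; Görtz–Wedhorn I (7.15),
The Stacks Project, Tag 01CL) — we assemble:

* `exists_torsionFree_idealPow_twist` — **the twist package**: given, for every coherent
  `𝒪_{S′}`-module `G` without `𝓙`-torsion and each member `U_k` of a FINITE family of opens of `X`,
  the vanishing of `Ȟ¹` of `𝓙ⁿG` on some family of affine opens with union `r⁻¹U_k` for all
  `n ≫ 0` (hypothesis `hLV` — for `r` a blow-up along `J` and `U_k` affine this is Serre's
  vanishing theorem on `r⁻¹U_k = Bl_{J(U_k)}(U_k) ↪ 𝐏^m`, where `𝒪(1) = 𝓙`; supplied elsewhere),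
  there are `𝒪_{S′}`-modules `P`, `N` and a zig-zag `r^*M —α→ P ←ψ— N` with `N` affine-localizing,
  `α` and `ψ` bijective on the sections over `r⁻¹V` for every affine open `V ⊆ X` disjoint from the
  support of `J` whose preimage `r⁻¹V` is affine (e.g. `r` an isomorphism over `X ∖ supp J`), and
  `Ȟ¹(r⁻¹U_k, N) = 0` in the above sense for EVERY `k` (one exponent `n` for the whole finite
  family).  Namely `P = r^*M/(r^*M)[𝓙ᵏ]`, `α` the quotient map, `N = 𝓙ⁿP`, `ψ` the inclusion:
  off `supp J` the ideal `𝓙` is the unit ideal, so the torsion has no sections and `𝓙ⁿP = P` there.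
* `ideal_comap_pow_eq_top_of_disjoint` — `(𝓙ⁿ)(W) = Γ(W, 𝒪)` for an affine `W ⊆ r⁻¹V`, `V` disjoint
  from `supp J`.

Role: step S6 (global half) of route (δ) «domination + divisorial twist» for the W4.4 door
`NoZeno.GWH2ResolutionDim2` (res-hironaka [INPUTS], 2026-08-28); the output is verbatim the
contract `standIn_S6` of the assembly skeleton, modulo the local vanishing `hLV`.  Everything is
proved; no named facts; no definitions.  Mathlib searched (pin v4.32): `IdealSheafData.support_comap`,
`IdealSheafData.mem_support_iff_of_mem`, `IsAffineOpen.iSup_basicOpen_eq_self_iff`,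
`Submodule.top_smul`, `Finset.le_sup` (used).

## References

* R. Hartshorne, *Algebraic Geometry*, GTM 52 (1977): II Ex. 5.6 (d) (p. 124), II Prop. 5.6,
  III Thm. 5.2 (b) (the vanishing `hLV` abstracts). [Hartshorne1977]
* U. Görtz, T. Wedhorn, *Algebraic Geometry I*, 2nd ed. (2020): (7.15), Prop. 7.14 (p. 186).
  [GortzWedhorn2020]
* The Stacks Project, Tag 01CL (Modules, §17.13). [StacksProject]
-/

noncomputable section

-- `TopCat.Presheaf`/`TopCat.Sheaf` are not reducible (as in Mathlib's `AlgebraicGeometry/Modules`).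
set_option backward.isDefEq.respectTransparency false

open CategoryTheory CategoryTheory.Limits AlgebraicGeometry TopologicalSpace Opposite
open Literature.AlgebraicGeometry.Modules

universe u v

namespace Literature.AlgebraicGeometry.Morphisms

/-! ## The inverse image ideal is the unit ideal off the support -/

section Support

variable {X S' : Scheme.{u}} (r : S' ⟶ X) (J : X.IdealSheafData)

/-- On an affine open all of whose points lie outside the support of an ideal sheaf, the ideal of
sections is the unit ideal (the basic opens of its members cover the open).
[cite: StacksProject, Tag 01CL] -/
private theorem ideal_eq_top_of_forall_not_mem {Y : Scheme.{u}} (I : Y.IdealSheafData)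
    (W : Y.affineOpens) (hW : ∀ p ∈ (W : Y.Opens), p ∉ I.support) : I.ideal W = ⊤ := by
  have h := (W.2.iSup_basicOpen_eq_self_iff (s := (I.ideal W : Set Γ(Y, W)))).mp
    (le_antisymm (iSup_le fun x => Y.basicOpen_le _) fun p hp => by
      have hps : p ∉ I.support := hW p hp
      rw [Scheme.IdealSheafData.mem_support_iff_of_mem hp, Scheme.mem_zeroLocus_iff] at hps
      push Not at hps
      obtain ⟨x, hx, hpx⟩ := hps
      exact Opens.mem_iSup.mpr ⟨⟨x, hx⟩, hpx⟩)
  rwa [Ideal.span_eq] at h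

/-- **`(𝓙ⁿ)(W) = Γ(W, 𝒪_{S′})`** for `𝓙 = J·𝒪_{S′}`, an affine open `W ⊆ r⁻¹V` and `V` disjoint
from the support of `J`. [cite: StacksProject, Tag 01CL] -/
theorem ideal_comap_pow_eq_top_of_disjoint {V : X.Opens} (hV : Disjoint (V : Set X) J.support)
    (W : S'.affineOpens) (hW : (W : S'.Opens) ≤ r ⁻¹ᵁ V) (n : ℕ) :
    ((J.comap r) ^ n).ideal W = ⊤ := by
  have h1 : (J.comap r).ideal W = ⊤ := by
    refine ideal_eq_top_of_forall_not_mem (J.comap r) W fun p hp hps => ?_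
    rw [Scheme.IdealSheafData.support_comap] at hps
    exact Set.disjoint_left.mp hV (hW hp) hps
  rw [Scheme.IdealSheafData.ideal_pow, Pi.pow_apply, h1, Ideal.top_pow]

end Support

/-! ## The package -/

section Package

variable {A : Type u} [CommRing A] {X S' : Scheme.{u}} [IsLocallyNoetherian X]
  [IsLocallyNoetherian S'] [CompactSpace S'] (fS : S' ⟶ Spec (.of A)) (r : S' ⟶ X)
  (J : X.IdealSheafData) (M : X.Modules) (hM : Coh M)

include hM in
/-- **The torsion-free twist package, reduced to the local vanishing of `H¹(r⁻¹U_k, 𝓙ⁿG)`.**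
For `r : S′ → X` (`X`, `S′` locally Noetherian, `S′` quasi-compact), an ideal sheaf `J` on `X` with
`𝓙 = J·𝒪_{S′}`, a coherent `M` on `X` and a finite family `(U_k)` of opens of `X`: IF for every
coherent `𝒪_{S′}`-module `G` without `𝓙`-torsion (a section over an affine open killed by `𝓙`
vanishes) and every `k` there is `d₀` such that for all `n ≥ d₀` every Čech `1`-cocycle of `𝓙ⁿG`
on some family of affine opens with union `r⁻¹U_k` is a coboundary (`hLV`), THEN there are
`P`, `N` and a zig-zag `r^*M —α→ P ←ψ— N` with `N` affine-localizing, `α`, `ψ` bijective on the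
sections over `r⁻¹V` for every affine `V` disjoint from `supp J` with `r⁻¹V` affine, and the
same `Ȟ¹`-vanishing for `N` on every `r⁻¹U_k` (`P = r^*M/(r^*M)[𝓙ᵏ]` the torsion-free quotient,
`N = 𝓙ⁿP` with one `n` for the whole family).
[cite: Hartshorne1977, II Ex. 5.6 (d) (p. 124) with III Thm. 5.2 (b)] -/
theorem exists_torsionFree_idealPow_twist {K : Type v} [Finite K] (U : K → X.Opens)
    (hLV : ∀ (G : S'.Modules), Coh G →
      (∀ (V : S'.Opens) (hV : IsAffineOpen V) (q : Γ(G, V)),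
        (∀ a ∈ (J.comap r).ideal ⟨V, hV⟩, a • q = 0) → q = 0) →
      ∀ k : K, ∃ d₀ : ℕ, ∀ n, d₀ ≤ n → ∃ (κ : Type u) (T : κ → S'.Opens),
        (∀ t, IsAffineOpen (T t)) ∧ ⨆ t, T t = r ⁻¹ᵁ U k ∧
        cechMZ1 fS (idealMul G ((J.comap r) ^ n)) T ≤ cechMB1 fS (idealMul G ((J.comap r) ^ n)) T) :
    ∃ (P N : S'.Modules) (α : (Scheme.Modules.pullback r).obj M ⟶ P) (ψ : N ⟶ P),
      IsAffineLocalizing N ∧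
      (∀ V : X.Opens, IsAffineOpen V → Disjoint (V : Set X) J.support → IsAffineOpen (r ⁻¹ᵁ V) →
        Function.Bijective (α.app (r ⁻¹ᵁ V)) ∧ Function.Bijective (ψ.app (r ⁻¹ᵁ V))) ∧
      ∀ k, ∃ (κ : Type u) (T : κ → S'.Opens), (∀ t, IsAffineOpen (T t)) ∧
        ⨆ t, T t = r ⁻¹ᵁ U k ∧ cechMZ1 fS N T ≤ cechMB1 fS N T := by
  classical
  -- the coherent inverse image and its stable `𝓙`-power torsion
  set G₀ : S'.Modules := (Scheme.Modules.pullback r).obj M with hG₀def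
  have hG₀ : Coh G₀ := coh_pullback r M hM
  set 𝓙 : S'.IdealSheafData := J.comap r with h𝓙def
  obtain ⟨k, hk⟩ := exists_torsion_pow_stable (M := G₀) (J := 𝓙) hG₀.loc hG₀.ft
  -- the torsion-free quotient `P`
  set P : S'.Modules := cokernel (torsionι G₀ (𝓙 ^ k)) with hPdef
  set α : G₀ ⟶ P := cokernel.π (torsionι G₀ (𝓙 ^ k)) with hαdef
  have hS := shortExact_torsion G₀ (𝓙 ^ k)
  have hT : IsAffineLocalizing (torsion G₀ (𝓙 ^ k)) :=
    isAffineLocalizing_torsion (𝓙 ^ k) hG₀.loc (IdealSheafData.fg_ideal _)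
  have hP : Coh P := hG₀.cokernel_torsionι (𝓙 ^ k)
  have htf : ∀ (V : S'.Opens) (hV : IsAffineOpen V) (q : Γ(P, V)),
      (∀ a ∈ 𝓙.ideal ⟨V, hV⟩, a • q = 0) → q = 0 :=
    fun V hV q hq => torsionFree_cokernel_torsionι hG₀.loc hk hV q hq
  -- one exponent for the whole finite family
  obtain ⟨d₀, hd₀⟩ : ∃ d₀ : K → ℕ, ∀ k' n, d₀ k' ≤ n → ∃ (κ : Type u) (T : κ → S'.Opens),
      (∀ t, IsAffineOpen (T t)) ∧ ⨆ t, T t = r ⁻¹ᵁ U k' ∧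
      cechMZ1 fS (idealMul P (𝓙 ^ n)) T ≤ cechMB1 fS (idealMul P (𝓙 ^ n)) T := by
    choose d₀ hd₀ using hLV P hP htf
    exact ⟨d₀, hd₀⟩
  haveI : Fintype K := Fintype.ofFinite K
  set n : ℕ := Finset.univ.sup d₀ with hndef
  set N : S'.Modules := idealMul P (𝓙 ^ n) with hNdef
  refine ⟨P, N, α, idealMulι P (𝓙 ^ n), isAffineLocalizing_idealMul hP.loc, ?_, ?_⟩
  · intro V hV hVJ hW
    have htop : ∀ m : ℕ, (𝓙 ^ m).ideal ⟨r ⁻¹ᵁ V, hW⟩ = ⊤ := fun m =>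
      ideal_comap_pow_eq_top_of_disjoint r J hVJ ⟨r ⁻¹ᵁ V, hW⟩ le_rfl m
    constructor
    · -- `α`: injective because the torsion has no non-zero section over `r⁻¹V`, surjective on affines
      refine ⟨fun x y hxy => ?_, app_surjective_of_shortExact hS hT hW⟩
      have h0 : α.app (r ⁻¹ᵁ V) (x - y) = 0 := by rw [map_sub, hxy, sub_self]
      obtain ⟨t, ht⟩ := (sections_exact_of_shortExact hS (r ⁻¹ᵁ V)).2 (x - y) h0
      change (torsionι G₀ (𝓙 ^ k)).app _ t = x - y at ht
      have htor := (isTorsionSection_iff_of_isAffineOpen G₀ (𝓙 ^ k) hW _).mp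
        (isTorsionSection_torsionι_app G₀ (𝓙 ^ k) _ t) 1 (by rw [htop]; trivial)
      rw [one_smul, ht] at htor
      exact (sub_eq_zero.mp htor)
    · -- `ψ`: the inclusion `𝓙ⁿP ⊆ P` is onto because `(𝓙ⁿ)(r⁻¹V)` is the unit ideal
      refine ⟨idealMulι_app_injective P (𝓙 ^ n) _, fun m => ?_⟩
      refine exists_idealMulι_app_eq P (𝓙 ^ n) m (isIdealMulSection_of_mem hW ?_)
      rw [htop, Submodule.top_smul]
      trivial
  · intro k'
    exact hd₀ k' n (Finset.le_sup (Finset.mem_univ k'))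

end Package

end Literature.AlgebraicGeometry.Morphisms

end
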